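import Summits.Ventures.LatticeQCDFlow.Scaling.LazyHotUnitSurvival
import Summits.Ventures.LatticeQCDFlow.Scaling.UnitSurvivalFloor

/-!
HONEST FRAMING: exact (Metropolis-corrected) sampling algorithms for lattice gauge theory; figures
of merit are autocorrelation/cost numbers at stated couplings and volumes; no continuum-physics
claim.

# LazyHotUnitSurvivalFloor — THE FLOOR SEES THE HOT SAMPLER'S REFRESH ODDS: FOR THE IDEALISED HOT-ONLY STAR WHOSE HOT
# KERNEL HOLDS WITH PROBABILITY `≥ 1 − a`, `d(n) ≥ (1 − t(1−θ)ĉ/m)ⁿ − (K+1)ν(s)` FOR EVERY `θ ≤ t/(t + a(1−t))`, HENCE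
# `t_mix(ε) ≥ ((t + a(1−t))·m/(t·a(1−t)·ĉ) − 1)·log(1/(ε + (K+1)ν(s)))` AND, AT UNIFORM LISTING ON A LARGE SPACE,
# `t_mix(1/4) ≥ ((t + a(1−t))·K/(t·a(1−t)) − 1)·log 2` (lean-2 GEN-27, ours)

Venture-side (OURS).  Cell `lqcd-flow` (pub-lqcd), unit `pub-lqcd-lean-2-g27`, 2026-08-27/28.  Chapter M, the floor
side, file 10: `Scaling/LazyHotUnitSurvival` (the `θ`-potential) fed through the separating event and the generic
floor lemma of `Scaling/UnitSurvivalFloor`.  Setting: idealised hot-only star (one positive unit-mass law `ν`,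
identity maps, multiplicities `≤ ĉ ≤ m`, `K ≥ 1`), hot kernel row-stochastic with `M_0(u,u) ≥ 1 − a`; for the
mixing-time statements `0 < t < 1`, `0 < a`, `ν`-reversible kernels and `ε`-closeness at some time.

## What is proved

* **`lazy_unitSurvival_worstTvDist_ge`** — `0 ≤ θ ≤ 1`, `θ ≤ t + (1−t)(1−a)θ`:
  `d(n) ≥ (1 − t(1−θ)ĉ/m)ⁿ − (K+1)·ν(s)` for every state `s`.
* **`lazy_unitSurvival_mixingTime_ge`** — at `θ* = t/(t + a(1−t))` (`1 − θ* = a(1−t)/(t + a(1−t))`):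
  `t_mix(ε) ≥ ((t + a(1−t))m/(t·a(1−t)·ĉ) − 1)·log(1/(ε + (K+1)ν(s)))`.
* **`lazy_unitSurvival_mixingTime_ge_quarter_of_card`** — `|S| ≥ 4(K+1)`: `… ·log 2` at `ε = 1/4`;
  **`lazy_uniformStar_unitSurvival_floor`** — `m = cK`, multiplicities `≤ c`:
  `t_mix(1/4) ≥ ((t + a(1−t))K/(t·a(1−t)) − 1)·log 2`.

Reading (no numerics implied): `(t + a(1−t))/(t·a(1−t)) = 1/(a(1−t)) + 1/t`: against `Scaling/UnitSurvivalFloor`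
(`1/(1−t) + 1/t`, any hot kernel) the refresh term is divided by the hot sampler's moving probability `a` — an
independence sampler that accepts one proposal in `1/a` cannot be rescued by swapping more often, and with the ceiling
of `Scaling/DoeblinHotSampler` (`2m/(tcp)` once `4t ≤ p(1−t)·a·w_0`) both sides of chapter M now carry the factor
`a`.  NOT CLAIMED: the `log K` for lazy samplers; cold-level moves; hot kernels without a holding bound (they obey
`Scaling/UnitSurvivalFloor` only); anything measured.  Literature grade (cell rule): OWN RESULT; nothing cited as a
fact; no new bib keys.
-/

noncomputable section

open Finset Function
open Literature.Probability.MarkovChains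

namespace Summit.Ventures.LatticeQCDFlow.Scaling

variable {S : Type*} [Fintype S] [DecidableEq S] {K m : ℕ} {ν : S → ℝ} {M : Fin (K + 1) → S → S → ℝ} {t θ a : ℝ}

section LazyFloor
variable (κ : Fin m → Fin K)

/-- **THE DISTANCE FLOOR WITH A HOLDING HOT KERNEL: `d(n) ≥ (1 − t(1−θ)ĉ/m)ⁿ − (K+1)·ν(s)`** for every state `s`
(`0 ≤ t ≤ 1`, `0 ≤ θ ≤ 1`, `θ ≤ t + (1−t)(1−a)θ`, `M_0(u,u) ≥ 1 − a`, multiplicities `≤ ĉ ≤ m`, `K ≥ 1`). [ours] -/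
theorem lazy_unitSurvival_worstTvDist_ge (hK : 1 ≤ K) (hm : 1 ≤ m) (ht0 : 0 ≤ t) (ht1 : t ≤ 1) (hθ0 : 0 ≤ θ)
    (hθ1 : θ ≤ 1) (hν : ∀ v, 0 < ν v) (hν1 : ∑ v, ν v = 1) (hM : ∀ k, IsRowStochastic (M k))
    (hhold : ∀ u, 1 - a ≤ M 0 u u) (hθ : θ ≤ t + (1 - t) * (1 - a) * θ)
    {cmax : ℕ} (hc : ∀ p' : Fin K, (univ.filter (fun r : Fin m => κ r = p')).card ≤ cmax) (hcm : cmax ≤ m)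
    (s : S) (n : ℕ) :
    (1 - t * (1 - θ) * cmax / m) ^ n - ((K : ℝ) + 1) * ν s ≤ worstTvDist (fun y z : Fin (K + 1) → S => t * ptGraphSwap (fun _ : Fin (K + 1) => ν)
          (fun r : Fin m => (((0 : Fin (K + 1)), (κ r).succ) : Fin (K + 1) × Fin (K + 1))) (fun _ => Equiv.refl S) y z
        + (1 - t) * prodKernel (fun k : Fin (K + 1) => if k = 0 then (1 : ℝ) else 0) M y z) (tensorFun (fun _ : Fin (K + 1) => ν)) n := by
  set Ψ : (Fin (K + 1) → S) → ℝ := fun z => if (∃ k : Fin K, z k.succ = s) then (1 : ℝ) else (if z 0 = s then θ else 0)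
    with hΨ_def
  have hΨ : ∀ z, Ψ z = if (∃ k : Fin K, z k.succ = s) then (1 : ℝ) else (if z 0 = s then θ else 0) := fun _ => rfl
  set P := (fun y z : Fin (K + 1) → S => t * ptGraphSwap (fun _ : Fin (K + 1) => ν)
          (fun r : Fin m => (((0 : Fin (K + 1)), (κ r).succ) : Fin (K + 1) × Fin (K + 1))) (fun _ => Equiv.refl S) y z
        + (1 - t) * prodKernel (fun k : Fin (K + 1) => if k = 0 then (1 : ℝ) else 0) M y z) with hP_def
  set x : Fin (K + 1) → S := fun _ => s with hx_def
  have hμ : ∀ (k : Fin (K + 1)) (v : S), 0 < (fun _ : Fin (K + 1) => ν) k v := fun _ v => hν v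
  have hμ1 : ∀ k : Fin (K + 1), ∑ v, (fun _ : Fin (K + 1) => ν) k v = 1 := fun _ => hν1
  have hw0 : ∀ k : Fin (K + 1), 0 ≤ (if k = 0 then (1 : ℝ) else 0) := fun k => by split_ifs <;> norm_num
  have hw1 : ∑ k : Fin (K + 1), (if k = 0 then (1 : ℝ) else 0) = 1 := by
    rw [Finset.sum_ite_eq' univ (0 : Fin (K + 1)), if_pos (mem_univ _)]
  have hPst : IsRowStochastic P := weightedScheme_isRowStochastic (t := t)
    (w := fun k : Fin (K + 1) => if k = 0 then (1 : ℝ) else 0)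
    (ptGraphSwap_isRowStochastic (e := fun r : Fin m => (((0 : Fin (K + 1)), (κ r).succ) : Fin (K + 1) × Fin (K + 1)))
      (φ := fun _ => Equiv.refl S) hμ) hM hw0 hw1 ht0 ht1
  have hΨx : Ψ x = 1 := by rw [hΨ, if_pos ⟨⟨0, by omega⟩, rfl⟩]
  have hmean := lazy_scheme_lawAt_survPot_ge κ hm ht0 ht1 hθ0 hθ1 hν hM hhold hθ hc hcm s hΨ x n
  rw [hΨx, mul_one] at hmean
  have hnn : ∀ z, 0 ≤ lawAt P (Pi.single x 1) n z := fun z => lawAt_nonneg hPst (fun a => by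
    by_cases ha : a = x
    · subst ha; rw [Pi.single_eq_same]; norm_num
    · rw [Pi.single_eq_of_ne ha]) n z
  have hev : lawMean (lawAt P (Pi.single x 1) n) Ψ
      ≤ ∑ z ∈ univ.filter (fun z : Fin (K + 1) → S => ∃ k ∈ (univ : Finset (Fin (K + 1))), z k = x k),
          lawAt P (Pi.single x 1) n z := by
    unfold lawMean
    rw [Finset.sum_filter]
    refine sum_le_sum fun z _ => ?_
    have h := mul_le_mul_of_nonneg_left (survPotθ_le_indicator hθ1 s hΨ z) (hnn z)
    calc lawAt P (Pi.single x 1) n z * Ψ z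
        ≤ lawAt P (Pi.single x 1) n z
          * (if (∃ k ∈ (univ : Finset (Fin (K + 1))), z k = (fun _ : Fin (K + 1) => s) k) then (1 : ℝ) else 0) := h
      _ = if (∃ k ∈ (univ : Finset (Fin (K + 1))), z k = x k) then lawAt P (Pi.single x 1) n z else 0 := by
          split_ifs <;> ring
  have hπA := tensorFun_mass_someKept_le hμ hμ1 x (univ : Finset (Fin (K + 1)))
  have hπA' : ∑ z ∈ univ.filter (fun z : Fin (K + 1) → S => ∃ k ∈ (univ : Finset (Fin (K + 1))), z k = x k),
      tensorFun (fun _ : Fin (K + 1) => ν) z ≤ ((K : ℝ) + 1) * ν s := by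
    refine hπA.trans (le_of_eq ?_)
    simp only [hx_def, sum_const, card_univ, Fintype.card_fin, nsmul_eq_mul, Nat.cast_add, Nat.cast_one]
  have hmass : ∑ z, lawAt P (Pi.single x 1) n z = ∑ z, tensorFun (fun _ : Fin (K + 1) => ν) z := by
    rw [sum_lawAt hPst, Finset.sum_pi_single', if_pos (mem_univ _), sum_tensorFun_eq_one _ hμ1]
  have htv := sub_sum_le_tvDist hmass
    (univ.filter (fun z : Fin (K + 1) → S => ∃ k ∈ (univ : Finset (Fin (K + 1))), z k = x k))
  have hw := tvDist_single_le_worstTvDist P (tensorFun (fun _ : Fin (K + 1) => ν)) n x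
  linarith

/-- **THE FLOOR WITH THE HOT SAMPLER'S REFRESH ODDS:** `0 < t < 1`, `0 < a`, `M_0(u,u) ≥ 1 − a`, `ν`-reversible
kernels, multiplicities `≤ ĉ` with `1 ≤ ĉ ≤ m`, any state `s`, `ε`-close at some time:
**`t_mix(ε) ≥ ((t + a(1−t))·m/(t·a(1−t)·ĉ) − 1)·log(1/(ε + (K+1)ν(s)))`** (the potential at `θ* = t/(t + a(1−t))`).
[ours] -/
theorem lazy_unitSurvival_mixingTime_ge (hK : 1 ≤ K) (hm : 1 ≤ m) (ht0 : 0 < t) (ht1 : t < 1) (ha0 : 0 < a) (hν : ∀ v, 0 < ν v) (hν1 : ∑ v, ν v = 1) (hM : ∀ k, IsRowStochastic (M k))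
    (hMrev : ∀ k, DetailedBalance ν (M k)) (hhold : ∀ u, 1 - a ≤ M 0 u u) {cmax : ℕ} (hc1 : 1 ≤ cmax)
    (hc : ∀ p' : Fin K, (univ.filter (fun r : Fin m => κ r = p')).card ≤ cmax) (hcm : cmax ≤ m) (s : S) {ε : ℝ}
    (hmix : ∃ t₀, worstTvDist (fun y z : Fin (K + 1) → S => t * ptGraphSwap (fun _ : Fin (K + 1) => ν)
          (fun r : Fin m => (((0 : Fin (K + 1)), (κ r).succ) : Fin (K + 1) × Fin (K + 1))) (fun _ => Equiv.refl S) y z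
        + (1 - t) * prodKernel (fun k : Fin (K + 1) => if k = 0 then (1 : ℝ) else 0) M y z) (tensorFun (fun _ : Fin (K + 1) => ν)) t₀ ≤ ε) :
    ((t + a * (1 - t)) * (m : ℝ) / (t * a * (1 - t) * cmax) - 1) * Real.log (1 / (ε + ((K : ℝ) + 1) * ν s))
      ≤ (mixingTime (fun y z : Fin (K + 1) → S => t * ptGraphSwap (fun _ : Fin (K + 1) => ν)
          (fun r : Fin m => (((0 : Fin (K + 1)), (κ r).succ) : Fin (K + 1) × Fin (K + 1))) (fun _ => Equiv.refl S) y z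
        + (1 - t) * prodKernel (fun k : Fin (K + 1) => if k = 0 then (1 : ℝ) else 0) M y z) (tensorFun (fun _ : Fin (K + 1) => ν)) ε : ℝ) := by
  have hμ : ∀ (k : Fin (K + 1)) (v : S), 0 < (fun _ : Fin (K + 1) => ν) k v := fun _ v => hν v
  have hw0 : ∀ k : Fin (K + 1), 0 ≤ (if k = 0 then (1 : ℝ) else 0) := fun k => by split_ifs <;> norm_num
  have hw1 : ∑ k : Fin (K + 1), (if k = 0 then (1 : ℝ) else 0) = 1 := by
    rw [Finset.sum_ite_eq' univ (0 : Fin (K + 1)), if_pos (mem_univ _)]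
  have hPst := weightedScheme_isRowStochastic (t := t) (w := fun k : Fin (K + 1) => if k = 0 then (1 : ℝ) else 0)
    (ptGraphSwap_isRowStochastic (e := fun r : Fin m => (((0 : Fin (K + 1)), (κ r).succ) : Fin (K + 1) × Fin (K + 1)))
      (φ := fun _ => Equiv.refl S) hμ) hM hw0 hw1 ht0.le ht1.le
  have hst := (weightedScheme_detailedBalance (w := fun k : Fin (K + 1) => if k = 0 then (1 : ℝ) else 0)
    (ptGraphSwap_detailedBalance (e := fun r : Fin m => (((0 : Fin (K + 1)), (κ r).succ) : Fin (K + 1) × Fin (K + 1)))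
      (φ := fun _ => Equiv.refl S) hμ) (fun k => hMrev k) t).isStationary hPst.2
  have hmpos : (0 : ℝ) < m := Nat.cast_pos.mpr (by omega)
  have hcpos : (0 : ℝ) < cmax := Nat.cast_pos.mpr (by omega)
  have hcm' : (cmax : ℝ) ≤ m := by exact_mod_cast hcm
  have h1t : 0 < 1 - t := by linarith
  have hD : 0 < t + a * (1 - t) := by nlinarith [mul_pos ha0 h1t]
  -- the potential at `θ* = t/(t + a(1−t))`
  set θs : ℝ := t / (t + a * (1 - t)) with hθs
  have hθs0 : 0 ≤ θs := div_nonneg ht0.le hD.le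
  have hθs1 : θs ≤ 1 := by rw [hθs, div_le_one hD]; nlinarith [mul_pos ha0 h1t]
  have hθseq : θs = t + (1 - t) * (1 - a) * θs := by
    rw [hθs, eq_comm, ← sub_eq_zero]; field_simp; ring
  have h1θ : 1 - θs = a * (1 - t) / (t + a * (1 - t)) := by rw [hθs]; field_simp; ring
  have hlam_eq : t * (1 - θs) * (cmax : ℝ) / m = t * a * (1 - t) * cmax / ((t + a * (1 - t)) * m) := by
    rw [h1θ]; field_simp
  have hlam0 : 0 < t * (1 - θs) * (cmax : ℝ) / m := by
    rw [hlam_eq]; exact div_pos (mul_pos (mul_pos (mul_pos ht0 ha0) h1t) hcpos) (mul_pos hD hmpos)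
  have hlam1 : t * (1 - θs) * (cmax : ℝ) / m < 1 := by
    rw [div_lt_one hmpos]
    have h1 : t * (1 - θs) < 1 := by nlinarith
    have h2 : 0 ≤ t * (1 - θs) := mul_nonneg ht0.le (by linarith)
    nlinarith
  have h := mixingTime_ge_of_geom_floor hPst hst hlam0 hlam1
    (fun n => lazy_unitSurvival_worstTvDist_ge κ hK hm ht0.le ht1.le hθs0 hθs1 hν hν1 hM hhold hθseq.le hc hcm s n) hmix
  have e : (t + a * (1 - t)) * (m : ℝ) / (t * a * (1 - t) * cmax) - 1 = 1 / (t * (1 - θs) * (cmax : ℝ) / m) - 1 := by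
    rw [hlam_eq, one_div_div]
  rw [e]
  exact h

/-- **A LARGE CONFIGURATION SPACE SUPPLIES THE RARE VALUE (`|S| ≥ 4(K+1)`):
`t_mix(1/4) ≥ ((t + a(1−t))·m/(t·a(1−t)·ĉ) − 1)·log 2`.** [ours] -/
theorem lazy_unitSurvival_mixingTime_ge_quarter_of_card (hK : 1 ≤ K) (hS : 4 * (K + 1) ≤ Fintype.card S)
    (hm : 1 ≤ m) (ht0 : 0 < t) (ht1 : t < 1) (ha0 : 0 < a) (hν : ∀ v, 0 < ν v) (hν1 : ∑ v, ν v = 1)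
    (hM : ∀ k, IsRowStochastic (M k)) (hMrev : ∀ k, DetailedBalance ν (M k)) (hhold : ∀ u, 1 - a ≤ M 0 u u)
    {cmax : ℕ} (hc1 : 1 ≤ cmax) (hc : ∀ p' : Fin K, (univ.filter (fun r : Fin m => κ r = p')).card ≤ cmax)
    (hcm : cmax ≤ m)
    (hmix : ∃ t₀, worstTvDist (fun y z : Fin (K + 1) → S => t * ptGraphSwap (fun _ : Fin (K + 1) => ν)
          (fun r : Fin m => (((0 : Fin (K + 1)), (κ r).succ) : Fin (K + 1) × Fin (K + 1))) (fun _ => Equiv.refl S) y z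
        + (1 - t) * prodKernel (fun k : Fin (K + 1) => if k = 0 then (1 : ℝ) else 0) M y z) (tensorFun (fun _ : Fin (K + 1) => ν)) t₀ ≤ 1 / 4) :
    ((t + a * (1 - t)) * (m : ℝ) / (t * a * (1 - t) * cmax) - 1) * Real.log 2
      ≤ (mixingTime (fun y z : Fin (K + 1) → S => t * ptGraphSwap (fun _ : Fin (K + 1) => ν)
          (fun r : Fin m => (((0 : Fin (K + 1)), (κ r).succ) : Fin (K + 1) × Fin (K + 1))) (fun _ => Equiv.refl S) y z
        + (1 - t) * prodKernel (fun k : Fin (K + 1) => if k = 0 then (1 : ℝ) else 0) M y z) (tensorFun (fun _ : Fin (K + 1) => ν)) (1 / 4) : ℝ) := by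
  have hSpos : 0 < Fintype.card S := by omega
  haveI : Nonempty S := Fintype.card_pos_iff.mp hSpos
  obtain ⟨s, hs⟩ := exists_rare_state (μ := fun _ : Fin (K + 1) => ν) (fun _ => hν1)
  have hcard : (0 : ℝ) < Fintype.card S := Nat.cast_pos.mpr hSpos
  have hS' : 4 * ((K : ℝ) + 1) ≤ Fintype.card S := by exact_mod_cast hS
  have hsum : ∑ _k : Fin (K + 1), ν s = ((K : ℝ) + 1) * ν s := by
    simp only [sum_const, card_univ, Fintype.card_fin, nsmul_eq_mul, Nat.cast_add, Nat.cast_one]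
  rw [hsum] at hs
  have hδ : ((K : ℝ) + 1) * ν s ≤ 1 / 4 := hs.trans (by rw [div_le_iff₀ hcard]; linarith)
  have h := lazy_unitSurvival_mixingTime_ge κ hK hm ht0 ht1 ha0 hν hν1 hM hMrev hhold hc1 hc hcm s (ε := 1 / 4) hmix
  refine le_trans ?_ h
  have hmpos : (0 : ℝ) < m := Nat.cast_pos.mpr (by omega)
  have hcpos : (0 : ℝ) < cmax := Nat.cast_pos.mpr (by omega)
  have hcm' : (cmax : ℝ) ≤ m := by exact_mod_cast hcm
  have h1t : 0 < 1 - t := by linarith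
  have hat : 0 < t * a * (1 - t) := mul_pos (mul_pos ht0 ha0) h1t
  have hcoef : 0 ≤ (t + a * (1 - t)) * (m : ℝ) / (t * a * (1 - t) * cmax) - 1 := by
    rw [sub_nonneg, le_div_iff₀ (mul_pos hat hcpos)]
    -- `t·a·(1−t)·ĉ ≤ (t + a(1−t))·m`: `a(1−t) ≤ 1` gives `t·a(1−t) ≤ t ≤ t + a(1−t)`, and `ĉ ≤ m`
    have h1 : t * a * (1 - t) ≤ t + a * (1 - t) := by nlinarith [mul_pos ha0 h1t, mul_pos ht0 h1t]
    have h2 := mul_le_mul h1 hcm' hcpos.le (by nlinarith [mul_pos ha0 h1t])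
    linarith
  refine mul_le_mul_of_nonneg_left ?_ hcoef
  have hνs : 0 < ν s := hν s
  have hKν : 0 ≤ ((K : ℝ) + 1) * ν s := mul_nonneg (by positivity) hνs.le
  refine Real.log_le_log (by norm_num) ?_
  rw [le_div_iff₀ (by linarith)]
  linarith

/-- **UNIFORM LISTING (`m = cK`, every multiplicity `≤ c`): `t_mix(1/4) ≥ ((t + a(1−t))K/(t·a(1−t)) − 1)·log 2`** —
`(t + a(1−t))/(t·a(1−t)) = 1/(a(1−t)) + 1/t`: the refresh term of the unit `K/(t(1−t)) = K(1/(1−t) + 1/t)` is divided by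
the hot sampler's moving probability `a`. [ours] -/
theorem lazy_uniformStar_unitSurvival_floor (hK : 1 ≤ K) (hS : 4 * (K + 1) ≤ Fintype.card S) (ht0 : 0 < t)
    (ht1 : t < 1) (ha0 : 0 < a) (hν : ∀ v, 0 < ν v) (hν1 : ∑ v, ν v = 1)
    (hM : ∀ k, IsRowStochastic (M k)) (hMrev : ∀ k, DetailedBalance ν (M k)) (hhold : ∀ u, 1 - a ≤ M 0 u u)
    {c : ℕ} (hc1 : 1 ≤ c) (hc : ∀ p' : Fin K, (univ.filter (fun r : Fin m => κ r = p')).card ≤ c) (hmc : m = c * K)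
    (hmix : ∃ t₀, worstTvDist (fun y z : Fin (K + 1) → S => t * ptGraphSwap (fun _ : Fin (K + 1) => ν)
          (fun r : Fin m => (((0 : Fin (K + 1)), (κ r).succ) : Fin (K + 1) × Fin (K + 1))) (fun _ => Equiv.refl S) y z
        + (1 - t) * prodKernel (fun k : Fin (K + 1) => if k = 0 then (1 : ℝ) else 0) M y z) (tensorFun (fun _ : Fin (K + 1) => ν)) t₀ ≤ 1 / 4) :
    ((t + a * (1 - t)) * (K : ℝ) / (t * a * (1 - t)) - 1) * Real.log 2
      ≤ (mixingTime (fun y z : Fin (K + 1) → S => t * ptGraphSwap (fun _ : Fin (K + 1) => ν)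
          (fun r : Fin m => (((0 : Fin (K + 1)), (κ r).succ) : Fin (K + 1) × Fin (K + 1))) (fun _ => Equiv.refl S) y z
        + (1 - t) * prodKernel (fun k : Fin (K + 1) => if k = 0 then (1 : ℝ) else 0) M y z) (tensorFun (fun _ : Fin (K + 1) => ν)) (1 / 4) : ℝ) := by
  have hm : 1 ≤ m := by rw [hmc]; exact Nat.one_le_iff_ne_zero.mpr (Nat.mul_ne_zero (by omega) (by omega))
  have hcm : c ≤ m := by rw [hmc]; exact Nat.le_mul_of_pos_right c (by omega)
  have h := lazy_unitSurvival_mixingTime_ge_quarter_of_card κ hK hS hm ht0 ht1 ha0 hν hν1 hM hMrev hhold hc1 hc hcm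
    hmix
  have hcpos : (0 : ℝ) < c := Nat.cast_pos.mpr (by omega)
  have h1t : 0 < 1 - t := by linarith
  have e : (t + a * (1 - t)) * (m : ℝ) / (t * a * (1 - t) * c) = (t + a * (1 - t)) * (K : ℝ) / (t * a * (1 - t)) := by
    rw [hmc, Nat.cast_mul]
    field_simp
  rwa [e] at h

end LazyFloor

end Summit.Ventures.LatticeQCDFlow.Scaling

end
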